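import Mathlib.RingTheory.MvPowerSeries.Inverse
import Mathlib.RingTheory.MvPowerSeries.Order
import Mathlib.RingTheory.MvPowerSeries.Trunc
import Mathlib.Analysis.Complex.Basic
import Mathlib.Data.Nat.Factorial.Basic
import Mathlib.Algebra.BigOperators.Field

/-!
# The Euler derivation and the formal exponential / logarithm of a multivariate power series

Over `ℂ` (any `ℚ`-algebra would do): the Euler derivation `E F = Σ_α |α| F_α z^α` (`euler`,
`euler_mul`), the formal exponential `expf g = Σ_k g^k/k!` of a series without constant term
(`coeff_expf`, `euler_expf : E (exp g) = (E g) exp g`), uniqueness for the Euler equation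
`E F = w F` (`eq_of_euler_eq`), the Euler logarithm `eulerLog P` (`E h = (E P) P⁻¹`, `h(0) = 0`) and
**`expf_eulerLog : expf (eulerLog P) = P`** for `P(0) = 1`. Used to lift a commutative polynomial to
a noncommutative one with controlled inverse (`NcPolynomialLift.lean`). Mathlib has the univariate
`PowerSeries.exp` but no multivariate logarithm. All statements are folklore; grouping namespace
`GKVVW` (toolkit of the proof of [GrinshpanEtAl2015, Thm. 3.1]).

## References

* [GrinshpanEtAl2015] A. Grinshpan, D. S. Kaliuzhnyi-Verbovetskyi, V. Vinnikov, H. J. Woerdeman,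
  Contractive determinantal representations of stable polynomials on a matrix polyball, Math. Z. 283
  (2016) 25–37, proof of Thm. 3.1 (the lift `P = det(I - K Z_n)|_{commuting}` of `p`).
-/

noncomputable section

namespace Literature.Analysis.OperatorTheory
namespace GKVVW

open MvPowerSeries Finset
open scoped Nat

variable {σ : Type} [DecidableEq σ]

/-! ### The Euler derivation `E = Σ_j z_j ∂_j`: `E(z^α) = |α| z^α` -/

/-- The Euler derivation on multivariate power series: `(E F)_α = |α| F_α`. [folklore] -/
def euler : MvPowerSeries σ ℂ →ₗ[ℂ] MvPowerSeries σ ℂ where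
  toFun F := fun α => (α.degree : ℂ) * F α
  map_add' F G := by funext α; show (α.degree : ℂ) * (F α + G α) = _; rw [mul_add]; rfl
  map_smul' a F := by funext α; show (α.degree : ℂ) * (a * F α) = a * ((α.degree : ℂ) * F α); ring

omit [DecidableEq σ] in
/-- Coefficients of `euler F`. [folklore] -/
@[simp] theorem coeff_euler (F : MvPowerSeries σ ℂ) (α : σ →₀ ℕ) :
    coeff α (euler F) = (α.degree : ℂ) * coeff α F := rfl

/-- The Euler operator is a derivation. [folklore] -/
theorem euler_mul (F G : MvPowerSeries σ ℂ) : euler (F * G) = euler F * G + F * euler G := by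
  ext α
  rw [coeff_euler, map_add, coeff_mul, coeff_mul, coeff_mul, Finset.mul_sum, ← Finset.sum_add_distrib]
  refine Finset.sum_congr rfl fun x hx => ?_
  rw [Finset.mem_antidiagonal] at hx
  rw [coeff_euler, coeff_euler, ← hx, map_add, Nat.cast_add]
  ring

/-- `E 1 = 0`. [folklore] -/
theorem euler_one : euler (1 : MvPowerSeries σ ℂ) = 0 := by
  ext α
  rw [coeff_euler, coeff_one, map_zero]
  split_ifs with h
  · rw [h, map_zero, Nat.cast_zero, zero_mul]
  · rw [mul_zero]

/-- `E (F^{k+1}) = (k+1) F^k E F`. [folklore] -/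
theorem euler_pow_succ (F : MvPowerSeries σ ℂ) (k : ℕ) :
    euler (F ^ (k + 1)) = ((k + 1 : ℕ) : ℂ) • (F ^ k * euler F) := by
  induction k with
  | zero => rw [zero_add, pow_one, pow_zero, one_mul, Nat.cast_one, one_smul]
  | succ k ih =>
    rw [pow_succ, euler_mul, ih, smul_mul_assoc, mul_assoc, mul_comm (euler F) F, ← mul_assoc,
      ← pow_succ, Nat.cast_succ (k + 1), add_smul, one_smul]

/-! ### The formal exponential of a series without constant term -/

omit [DecidableEq σ] in
/-- Powers of a series without constant term have no low coefficients. [folklore] -/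
theorem coeff_pow_eq_zero_of_degree_lt {g : MvPowerSeries σ ℂ} (hg : constantCoeff g = 0)
    {α : σ →₀ ℕ} {k : ℕ} (h : α.degree < k) : coeff α (g ^ k) = 0 := by
  apply coeff_of_lt_order
  exact lt_of_lt_of_le (by exact_mod_cast h) (le_order_pow_of_constantCoeff_eq_zero k hg)

/-- **The formal exponential** `exp g = Σ_k g^k/k!` of a power series `g` without constant term
(each coefficient is a finite sum). [folklore] -/
def expf (g : MvPowerSeries σ ℂ) : MvPowerSeries σ ℂ :=
  fun α => ∑ k ∈ range (α.degree + 1), coeff α (g ^ k) / (k ! : ℂ)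

omit [DecidableEq σ] in
/-- Coefficients of `expf g`, with any large enough summation bound. [folklore] -/
theorem coeff_expf {g : MvPowerSeries σ ℂ} (hg : constantCoeff g = 0) (α : σ →₀ ℕ) {N : ℕ}
    (hN : α.degree ≤ N) : coeff α (expf g) = ∑ k ∈ range (N + 1), coeff α (g ^ k) / (k ! : ℂ) := by
  show ∑ k ∈ range (α.degree + 1), coeff α (g ^ k) / (k ! : ℂ) = _
  rw [← Finset.sum_range_add_sum_Ico _ (Nat.succ_le_succ hN)]
  rw [Finset.sum_eq_zero (s := Finset.Ico _ _), add_zero]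
  intro k hk
  rw [coeff_pow_eq_zero_of_degree_lt hg (Nat.lt_of_succ_le (Finset.mem_Ico.mp hk).1), zero_div]

omit [DecidableEq σ] in
/-- `expf g` has constant term `1`. [folklore] -/
theorem constantCoeff_expf {g : MvPowerSeries σ ℂ} (hg : constantCoeff g = 0) :
    constantCoeff (expf g) = 1 := by
  rw [← coeff_zero_eq_constantCoeff_apply, coeff_expf hg 0 (N := 0) (by simp)]
  simp

/-- **`E (exp g) = E g · exp g`.** [folklore] -/
theorem euler_expf {g : MvPowerSeries σ ℂ} (hg : constantCoeff g = 0) :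
    euler (expf g) = euler g * expf g := by
  ext α
  set N := α.degree with hN
  -- left side: `|α| Σ_{k ≤ N} (g^k)_α / k! = Σ_{k ≤ N} (E g^k)_α / k! = Σ_{j < N} (g^j E g)_α / j!`
  have hL : coeff α (euler (expf g)) = ∑ j ∈ range N, coeff α (g ^ j * euler g) / (j ! : ℂ) := by
    rw [coeff_euler, coeff_expf hg α le_rfl, Finset.mul_sum, Finset.sum_range_succ', pow_zero,
      coeff_one]
    have h0 : (α.degree : ℂ) * ((if α = 0 then 1 else 0) / (0 ! : ℂ)) = 0 := by
      split_ifs with h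
      · rw [h, map_zero, Nat.cast_zero, zero_mul]
      · rw [zero_div, mul_zero]
    rw [h0, add_zero]
    refine Finset.sum_congr rfl fun j _ => ?_
    have := congrArg (coeff α) (euler_pow_succ g j)
    rw [coeff_euler, map_smul, smul_eq_mul] at this
    rw [mul_div_assoc', this, Nat.factorial_succ, Nat.cast_mul,
      mul_div_mul_left _ _ (by exact_mod_cast Nat.succ_ne_zero j : ((j + 1 : ℕ) : ℂ) ≠ 0)]
  -- right side
  have hR : coeff α (euler g * expf g) = ∑ j ∈ range N, coeff α (g ^ j * euler g) / (j ! : ℂ) := by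
    rw [coeff_mul]
    have hterm : ∀ x ∈ Finset.antidiagonal α, coeff x.1 (euler g) * coeff x.2 (expf g) =
        ∑ j ∈ range (N + 1), coeff x.1 (euler g) * coeff x.2 (g ^ j) / (j ! : ℂ) := by
      intro x hx
      have hx2 : x.2.degree ≤ N := by
        rw [Finset.mem_antidiagonal] at hx
        rw [hN, ← hx, map_add]; exact Nat.le_add_left _ _
      rw [coeff_expf hg x.2 hx2, Finset.mul_sum]
      refine Finset.sum_congr rfl fun j _ => ?_
      rw [mul_div_assoc']
    rw [Finset.sum_congr rfl hterm, Finset.sum_comm]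
    rw [Finset.sum_range_succ]
    have hlast : ∑ x ∈ Finset.antidiagonal α, coeff x.1 (euler g) * coeff x.2 (g ^ N) / (N ! : ℂ) = 0 := by
      refine Finset.sum_eq_zero fun x hx => ?_
      rw [Finset.mem_antidiagonal] at hx
      by_cases h1 : x.1 = 0
      · rw [h1, coeff_euler, map_zero, Nat.cast_zero, zero_mul, zero_mul, zero_div]
      · have : x.2.degree < N := by
          have hdeg := congrArg Finsupp.degree hx
          rw [map_add] at hdeg
          have h1' : 0 < x.1.degree := Nat.pos_of_ne_zero fun h => h1 ((Finsupp.degree_eq_zero_iff _).mp h)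
          omega
        rw [coeff_pow_eq_zero_of_degree_lt hg this, mul_zero, zero_div]
    rw [hlast, add_zero]
    refine Finset.sum_congr rfl fun j _ => ?_
    rw [mul_comm (g ^ j), coeff_mul, Finset.sum_div]
  rw [hL, hR]

/-- **Uniqueness for the Euler equation.** Two series with the same constant term solving
`E F = w F` with `w(0) = 0` coincide. [folklore] -/
theorem eq_of_euler_eq {F G w : MvPowerSeries σ ℂ} (hw : constantCoeff w = 0)
    (hF : euler F = w * F) (hG : euler G = w * G) (h0 : constantCoeff F = constantCoeff G) :
    F = G := by
  suffices h : ∀ n : ℕ, ∀ α : σ →₀ ℕ, α.degree = n → coeff α F = coeff α G by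
    ext α; exact h _ α rfl
  intro n
  induction n using Nat.strong_induction_on with
  | _ n ih =>
    intro α hα
    by_cases hn : n = 0
    · subst hn
      rw [(Finsupp.degree_eq_zero_iff α).mp hα, coeff_zero_eq_constantCoeff_apply,
        coeff_zero_eq_constantCoeff_apply, h0]
    · have eF := congrArg (coeff α) hF
      have eG := congrArg (coeff α) hG
      rw [coeff_euler, coeff_mul] at eF eG
      have hsum : ∑ x ∈ Finset.antidiagonal α, coeff x.1 w * coeff x.2 F =
          ∑ x ∈ Finset.antidiagonal α, coeff x.1 w * coeff x.2 G := by
        refine Finset.sum_congr rfl fun x hx => ?_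
        rw [Finset.mem_antidiagonal] at hx
        by_cases h1 : x.1 = 0
        · rw [h1, coeff_zero_eq_constantCoeff_apply, hw, zero_mul, zero_mul]
        · congr 1
          apply ih x.2.degree _ x.2 rfl
          have hdeg := congrArg Finsupp.degree hx
          rw [map_add, hα] at hdeg
          have h1' : 0 < x.1.degree := Nat.pos_of_ne_zero fun h => h1 ((Finsupp.degree_eq_zero_iff _).mp h)
          omega
      rw [hsum, ← eG] at eF
      have hn' : (α.degree : ℂ) ≠ 0 := by rw [hα]; exact_mod_cast hn
      exact mul_left_cancel₀ hn' eF

/-! ### The formal logarithm of a series with constant term `1` -/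

/-- **The Euler logarithm** of `P` (`P(0) ≠ 0`): the series `h` with `h(0) = 0` and
`E h = (E P) · P⁻¹`, i.e. `h_α = ((E P) P⁻¹)_α / |α|`. [folklore] -/
def eulerLog (P : MvPowerSeries σ ℂ) : MvPowerSeries σ ℂ :=
  fun α => (α.degree : ℂ)⁻¹ * coeff α (euler P * P⁻¹)

omit [DecidableEq σ] in
/-- Coefficients of `eulerLog`. [folklore] -/
theorem coeff_eulerLog (P : MvPowerSeries σ ℂ) (α : σ →₀ ℕ) :
    coeff α (eulerLog P) = (α.degree : ℂ)⁻¹ * coeff α (euler P * P⁻¹) := rfl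

omit [DecidableEq σ] in
/-- `eulerLog P` has no constant term. [folklore] -/
theorem constantCoeff_eulerLog (P : MvPowerSeries σ ℂ) : constantCoeff (eulerLog P) = 0 := by
  rw [← coeff_zero_eq_constantCoeff_apply, coeff_eulerLog, map_zero, Nat.cast_zero, inv_zero, zero_mul]

omit [DecidableEq σ] in
/-- `(E P) P⁻¹` has no constant term. [folklore] -/
theorem constantCoeff_euler_mul_inv (P : MvPowerSeries σ ℂ) : constantCoeff (euler P * P⁻¹) = 0 := by
  rw [map_mul, ← coeff_zero_eq_constantCoeff_apply, coeff_euler, map_zero, Nat.cast_zero, zero_mul,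
    zero_mul]

/-- `E (eulerLog P) = (E P) P⁻¹`. [folklore] -/
theorem euler_eulerLog (P : MvPowerSeries σ ℂ) : euler (eulerLog P) = euler P * P⁻¹ := by
  ext α
  rw [coeff_euler, coeff_eulerLog]
  by_cases h : α = 0
  · rw [h, map_zero, Nat.cast_zero, zero_mul, coeff_zero_eq_constantCoeff_apply,
      constantCoeff_euler_mul_inv]
  · have : (α.degree : ℂ) ≠ 0 := by
      exact_mod_cast fun h' => h ((Finsupp.degree_eq_zero_iff α).mp h')
    rw [← mul_assoc, mul_inv_cancel₀ this, one_mul]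

/-- **`exp (log P) = P`** for a power series `P` with constant term `1`. [folklore] -/
theorem expf_eulerLog {P : MvPowerSeries σ ℂ} (hP : constantCoeff P = 1) :
    expf (eulerLog P) = P := by
  have hinv : P * P⁻¹ = 1 := MvPowerSeries.mul_inv_cancel P (by rw [hP]; exact one_ne_zero)
  refine eq_of_euler_eq (w := euler P * P⁻¹) (constantCoeff_euler_mul_inv P) ?_ ?_ ?_
  · rw [euler_expf (constantCoeff_eulerLog P), euler_eulerLog]
  · rw [mul_assoc, mul_comm P⁻¹ P, hinv, mul_one]
  · rw [constantCoeff_expf (constantCoeff_eulerLog P), hP]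

end GKVVW
end Literature.Analysis.OperatorTheory
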